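import Literature.NumberTheory.EllipticCurves.Rank1Residual.Typed.X7
import Literature.NumberTheory.EllipticCurves.Rank1Residual.Typed.X8
import Literature.NumberTheory.EllipticCurves.Rank1Residual.X9ChaCertificate
import HarnessLib

/-!
# Good supersingular classes X7 / X8 at a NON-SURJECTIVE prime: the PER-PAIR Cha 2005 index route (T-CHA), with `irr(p)` DISCHARGED by the class

HONEST FRAMING (cell `b2b-bsdres`, run/shared/lean/b2b/bsd-rank1-residual/, verbatim in every
file): the goal of the cell is to DELETE the COMBINATION-SHAPED residual classes of the
Birch–Swinnerton-Dyer formula for ALL analytic-rank `≤ 1` elliptic curves over `ℚ` — "full BSD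
formula for every rank `≤ 1` curve in class `C`" assembled STRICTLY from published theorems — so
that the rank-`≤ 1` remainder becomes exactly the CONSTRUCTION-SHAPED classes, which are TYPED
(missing-input `Prop`s), NOT attempted. This is not "finishing BSD". Harvest seat 1 (census
support of X6 / X7 / X8; prover owners x10b + additive-p3), generation 22. Theorems only
(compositions of tree theorems BY NAME); no definition, no named fact; X7 and X8 REMAIN
CONSTRUCTION-SHAPED; nothing is booked; PER PAIR.

## What this file records, and why

At a good supersingular prime `p ≠ 2` the mod-`p` image is IRREDUCIBLE (Serre 1972 Prop. 12; tree
`ClassX7.irr`, `ClassX8.irr'`), but it need not be SURJECTIVE: the census population of iw-2 GEN 7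
`tables/ss500k_unit_r0_Nn.tsv` — 361 rank-0 pairs `(E, p)` of the lane's v4 residue (`N < 5·10⁵`)
with unit BSD quotient `ord_p(#Ш_an · Tam / #T²) = 0` and Cremona image code `pNn` (normaliser of a
non-split Cartan: X7 247 = 188 @3 + 52 @5 + 4 @7 + 3 @11, X8 114 @3; six in the window
`N < 2·10⁴`: `5344a1, 10688b1, 16064b1 @3`, `17600ca1 @3` (X8), `6372a1, 18324a1 @5`). There EVERY
Kolyvagin-SYSTEM route is dead — no transvection in the image, so no Kolyvagin prime and no
Mazur–Rubin `τ` (tree: `GaloisImage/KolyvaginPrimeSmallImage.lean`,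
`galoisRepTorsion_frobenius_eq_one_of_irr_of_not_surj`; x9 `ClassX9.not_bigIm`) — which is why Kato
17.4 (3) / Kobayashi 4.1 (`n = 0`) / Kim's Kurihara numbers / KKS 2020 cannot be invoked and the
lane records "good supersingular p, not surjective" with no Heegner field tried. The printed
PER-PAIR routes that remain are the Heegner-INDEX rows at an irreducible prime: Cha 2005 (Miller
2011 Thm. 5.2; lane token T-CHA: `r ≤ 1`, `p ∤ 2 d_K`, `p² ∤ N`, `irr(p)`, `E` non-CM) and
Matar–Nekovář 2019 Thm. 0.3 / 6.7 (1) (T-MN19, booking shapes already in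
`Supersingular/HeegnerIndexRoute.lean`). This file adds the T-CHA twins on the classes, i.e. the
tree's general certificate `Typed.bsdp_of_cha_of_not_dvd_index` (x9 g6, `X9ChaCertificate.lean`)
with `irr(p)` discharged by the class predicate and `p ≠ 2` automatic on X8:

* `X7.bsdp_of_cha_of_not_dvd_index`, `X7.missingInputAt_of_cha_of_not_dvd_index`;
* `X8.bsdp_of_cha_of_not_dvd_index`, `X8.missingInputAt_of_cha_of_not_dvd_index`;
* `bsdp_of_goodSS_of_cha_of_not_dvd_index` — the common content (`GoodSS W p`, `p ≠ 2`).

Binders per pair: the Heegner field `K` with `p ∤ d_K` (lane rule GROSS-DpN is built into Cha's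
statement), the level `N` with `p² ∤ N` (at a good `p` this is `p ∤ N_E`; kept as a binder because
the level of the Heegner datum is an independent variable of the statement, as in
`X9.bsdp_of_cha_of_not_dvd_index`), `E` non-CM (`hcm`; the CM rank-0 good-supersingular pairs are
row C8 Rubin/Burungale–Flach, not X7's concern), a Heegner point `P` of infinite order with
`p ∤ [E(K) : ℤP]`, and `#Ш_an = q` with `ord_p q = 0`. For a RANK-ZERO `E` the point `P` lives in
the rank-one twist `E^{d_K}` (analytic rank of `E/K` equal to one); the certificate integer is
`m = [E(K) : ℤ y_K]` in Miller's normalisation (Thm. 4.1 / Cor. 4.8), computed per pair by the cell's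
two Heegner-index engines (harvest-1 g22 `HOME/b2b-bsdres-harvest-1/g22/ssr0nn/`: engine 1 =
x11c g3 `engine1_cha1` verbatim, engine 2 = stdlib `run_cert.py` verbatim; e.g. `6372a1 @5`:
`K = ℚ(√−23)`, `m = 4`; `18324a1 @5`: `K = ℚ(√−23)`, `m = 12`; both engines agree). Nothing booked
here; admissibility, the two-engine bar and the booking are the referee's and the lane's.

References: B. Cha, J. Number Theory 111 (2005) 154–178 [Cha2005]; R. L. Miller, LMS J. Comput.
Math. 14 (2011) 327–350, Thm. 5.2, Thm. 4.1, Cor. 4.8, Def. 1.1 [Miller2011LMS]; G. Grigorov,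
A. Jorza, S. Patrikis, W. Stein, C. Tarniţă, Math. Comp. 78 (2009) 2397–2425, Thm. 3.5
[GrigorovJorzaPatrikisSteinTarnita2009]; J.-P. Serre, Invent. Math. 15 (1972) §1.11 Prop. 12
[Serre1972]; A. Matar, J. Nekovář, JTNB 31 (2019) Thm. 0.3 / 6.7 (1) [MatarNekovar2019];
RESIDUAL-CASES.md §a.2 X7/X8; CLASS-OWNERS.md rows X7, X8; lane HYPOTHESES.md rows T-CHA / T-MN19.
-/

noncomputable section

open scoped Classical

open WeierstrassCurve Literature.NumberTheory.EllipticCurves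
  Literature.NumberTheory.EllipticCurves.Rank1Residual
  Literature.NumberTheory.EllipticCurves.Rank1Residual.Typed
  Literature.NumberTheory.EllipticCurves.Cha2005

namespace Summit.BirchSwinnertonDyer.Rank1Residual.Supersingular

variable (W : WeierstrassCurve ℚ) [W.IsElliptic] [W.IsGloballyMinimal] (p : ℕ) [hp : Fact p.Prime]

/-! ## §1 Class X7 (good supersingular, `E` not semistable) -/

/-- **X7: `BSD(E,p)` from Cha's index certificate, no image input.** For an X7 pair `(E, p)`
(`ClassX7 W p`: good supersingular at `p`, `E` not semistable) with `p ≠ 2`, `E` non-CM and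
analytic rank `≤ 1`: granted the PUBLISHED named fact `hCha` (Cha 2005 as Miller 2011 Thm. 5.2) and
GZK, the per-pair inputs are a Heegner field `K` (imaginary quadratic, Heegner hypothesis for the
level `N`, `p ∤ d_K`, `p² ∤ N`), a Heegner point `P` of infinite order with `p ∤ [E(K) : ℤP]`, and
`#Ш_an = q` with `ord_p q = 0`. `irr(p)` is `ClassX7.irr` (Serre Prop. 12); surjectivity is NOT
needed. Per pair; nothing booked.
[cite: Miller2011LMS, Thm. 5.2 and Def. 1.1] [cite: Serre1972, §1.11 Prop. 12] -/
theorem X7.bsdp_of_cha_of_not_dvd_index (hCha : thm52_padicValNat_shaOrder_le)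
    (hGZK : rank_eq_analyticRank_of_analyticRank_le_one) (hX : ClassX7 W p) (hp2 : p ≠ 2)
    (hcm : ¬ W.HasCM)
    {N : ℕ} [NeZero N] {K : Type} [Field K] [NumberField K] (hK : IsImaginaryQuadratic K)
    (hH : SatisfiesHeegnerHypothesis N K) {P : (W.baseChange K).toAffine.Point}
    (hP : IsHeegnerPoint N W K P) (hnt : ¬ IsOfFinAddOrder P)
    (hpD : ¬ (p : ℤ) ∣ NumberField.discr K) (hpN : ¬ p ^ 2 ∣ N)
    (hI : ¬ p ∣ (AddSubgroup.zmultiples P).index)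
    (hr : W.analyticRank ≤ 1) {q : ℚ} (hq : shaAn W = (q : ℂ)) (hv : padicValRat p q = 0) :
    BSDp W p :=
  Typed.bsdp_of_cha_of_not_dvd_index W p hCha hGZK hK hH hP hnt hcm hp2 hpD hpN
    (ClassX7.irr W p hp2 hX) hI hr hq hv

/-- … and X7's typed residue follows at such a pair. [cite: Miller2011LMS, Thm. 5.2 and Def. 1.1] -/
theorem X7.missingInputAt_of_cha_of_not_dvd_index (hCha : thm52_padicValNat_shaOrder_le)
    (hGZK : rank_eq_analyticRank_of_analyticRank_le_one) (hX : ClassX7 W p) (hp2 : p ≠ 2)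
    (hcm : ¬ W.HasCM)
    {N : ℕ} [NeZero N] {K : Type} [Field K] [NumberField K] (hK : IsImaginaryQuadratic K)
    (hH : SatisfiesHeegnerHypothesis N K) {P : (W.baseChange K).toAffine.Point}
    (hP : IsHeegnerPoint N W K P) (hnt : ¬ IsOfFinAddOrder P)
    (hpD : ¬ (p : ℤ) ∣ NumberField.discr K) (hpN : ¬ p ^ 2 ∣ N)
    (hI : ¬ p ∣ (AddSubgroup.zmultiples P).index)
    (hr : W.analyticRank ≤ 1) {q : ℚ} (hq : shaAn W = (q : ℂ)) (hv : padicValRat p q = 0) :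
    X7.MissingInputAt W p := by
  obtain ⟨-, hfin⟩ := hGZK W hr
  haveI : Finite W.sha := hfin
  have hB := X7.bsdp_of_cha_of_not_dvd_index W p hCha hGZK hX hp2 hcm hK hH hP hnt hpD hpN hI hr hq hv
  have hPP := missingPPartAt_of_bsdp W p hB
  exact ⟨fun _ _ _ ↦ (lower_and_upper_of_missingPPartAt W p hPP).1, fun _ ↦ hPP⟩

/-! ## §2 Class X8 (`p = 3` good supersingular, `a_3 = ±3`) -/

/-- **X8: `BSD(E,3)` from Cha's index certificate, no image input** (`ClassX8 W p`: `p = 3`, good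
supersingular at `3`, `a_3 ≠ 0`; `irr(3)` is `ClassX8.irr'`; Cha's bound allows `p = 3` since only
`p ∤ 2 d_K` is required). Per-pair inputs: `K` with `3 ∤ d_K`, level with `9 ∤ N`, `E` non-CM, a
Heegner point `P` of infinite order with `3 ∤ [E(K) : ℤP]`, and `ord_3 #Ш_an = 0`. Per pair;
nothing booked. [cite: Miller2011LMS, Thm. 5.2 and Def. 1.1] [cite: Serre1972, §1.11 Prop. 12] -/
theorem X8.bsdp_of_cha_of_not_dvd_index (hCha : thm52_padicValNat_shaOrder_le)
    (hGZK : rank_eq_analyticRank_of_analyticRank_le_one) (hX : ClassX8 W p) (hcm : ¬ W.HasCM)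
    {N : ℕ} [NeZero N] {K : Type} [Field K] [NumberField K] (hK : IsImaginaryQuadratic K)
    (hH : SatisfiesHeegnerHypothesis N K) {P : (W.baseChange K).toAffine.Point}
    (hP : IsHeegnerPoint N W K P) (hnt : ¬ IsOfFinAddOrder P)
    (hpD : ¬ (p : ℤ) ∣ NumberField.discr K) (hpN : ¬ p ^ 2 ∣ N)
    (hI : ¬ p ∣ (AddSubgroup.zmultiples P).index)
    (hr : W.analyticRank ≤ 1) {q : ℚ} (hq : shaAn W = (q : ℂ)) (hv : padicValRat p q = 0) :
    BSDp W p := by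
  have hp2 : p ≠ 2 := by rw [hX.1]; decide
  exact Typed.bsdp_of_cha_of_not_dvd_index W p hCha hGZK hK hH hP hnt hcm hp2 hpD hpN
    (ClassX8.irr' W p hX) hI hr hq hv

/-- … and X8's typed residue follows at such a pair. [cite: Miller2011LMS, Thm. 5.2 and Def. 1.1] -/
theorem X8.missingInputAt_of_cha_of_not_dvd_index (hCha : thm52_padicValNat_shaOrder_le)
    (hGZK : rank_eq_analyticRank_of_analyticRank_le_one) (hX : ClassX8 W p) (hcm : ¬ W.HasCM)
    {N : ℕ} [NeZero N] {K : Type} [Field K] [NumberField K] (hK : IsImaginaryQuadratic K)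
    (hH : SatisfiesHeegnerHypothesis N K) {P : (W.baseChange K).toAffine.Point}
    (hP : IsHeegnerPoint N W K P) (hnt : ¬ IsOfFinAddOrder P)
    (hpD : ¬ (p : ℤ) ∣ NumberField.discr K) (hpN : ¬ p ^ 2 ∣ N)
    (hI : ¬ p ∣ (AddSubgroup.zmultiples P).index)
    (hr : W.analyticRank ≤ 1) {q : ℚ} (hq : shaAn W = (q : ℂ)) (hv : padicValRat p q = 0) :
    X8.MissingInputAt W p := by
  obtain ⟨-, hfin⟩ := hGZK W hr
  haveI : Finite W.sha := hfin
  have hB := X8.bsdp_of_cha_of_not_dvd_index W p hCha hGZK hX hcm hK hH hP hnt hpD hpN hI hr hq hv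
  have hPP := missingPPartAt_of_bsdp W p hB
  exact ⟨fun _ _ ↦ (lower_and_upper_of_missingPPartAt W p hPP).1, fun _ ↦ hPP⟩

/-! ## §3 Any good supersingular pair -/

/-- **Good supersingular `p ≠ 2`, any non-CM `E`: the Cha booking shape with `irr(p)` from Serre
Prop. 12** (`GoodSS W p`: good reduction, `p ∣ a_p`). The common content of §1–§2.
[cite: Miller2011LMS, Thm. 5.2 and Def. 1.1] [cite: Serre1972, §1.11 Prop. 12] -/
theorem bsdp_of_goodSS_of_cha_of_not_dvd_index (hCha : thm52_padicValNat_shaOrder_le)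
    (hGZK : rank_eq_analyticRank_of_analyticRank_le_one) (hss : GoodSS W p) (hp2 : p ≠ 2)
    (hcm : ¬ W.HasCM)
    {N : ℕ} [NeZero N] {K : Type} [Field K] [NumberField K] (hK : IsImaginaryQuadratic K)
    (hH : SatisfiesHeegnerHypothesis N K) {P : (W.baseChange K).toAffine.Point}
    (hP : IsHeegnerPoint N W K P) (hnt : ¬ IsOfFinAddOrder P)
    (hpD : ¬ (p : ℤ) ∣ NumberField.discr K) (hpN : ¬ p ^ 2 ∣ N)
    (hI : ¬ p ∣ (AddSubgroup.zmultiples P).index)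
    (hr : W.analyticRank ≤ 1) {q : ℚ} (hq : shaAn W = (q : ℂ)) (hv : padicValRat p q = 0) :
    BSDp W p :=
  Typed.bsdp_of_cha_of_not_dvd_index W p hCha hGZK hK hH hP hnt hcm hp2 hpD hpN
    (hasIrreducibleModPGaloisRep_of_dvd_frobeniusTrace W p hp2
      (W.not_dvd_minimalDiscriminantInt_of_hasGoodReductionAtPrime' p hss.1) hss.2)
    hI hr hq hv

end Summit.BirchSwinnertonDyer.Rank1Residual.Supersingular

end
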